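import Summits.HubbardSuperconductivity.HubbardSuperconductivity.Theorems.InfiniteVolumeFirstCoarseTightnessMesoReductions

/-!
# Coarse tightness and the atom ceiling from a mesoscopic pair-order ceiling

Support for the cruxes `NoInfraredPileUp` (stmt-HubbardSuperconductivity-18534) and
`NoNormalLimitState` (stmt-HubbardSuperconductivity-18533) of route `InfiniteVolumeFirst`: the last
step (S10/S11) of the coarse-tightness / atom-ceiling programme (`PLAN-coarse-tightness.md` attached
to the item), written MODULO its one analytic input — a mesoscopic pair-order ceiling for the ground
states of the weakly repulsive Hubbard torus, taken here as an explicit HYPOTHESIS of the exact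
shape the programme produces (block pair Gram bound `blockPairGram_bound` + aggregation
`sum_le_of_gram_shell_budget` + the block kinetic budget):

  `(MC)  ∀ τ ∈ (0,1] ∀ R ≥ 1 ∀ L ≥ 2R + 2 ∀ U ∈ [0,1] ∀ n ∀ unit ground states ψ of hubbardTorus 2 L 1 U`
  `      in the sector (2n, S^z = 0):   𝓜_R(ψ) ≤ c₁/R + c₂ √τ + (c₃/√τ) √(U + c₄/R)`,

`𝓜_R(ψ) = (Σ_a ‖B_a ψ‖²)/(L² R⁴)`, `B_a = Σ_{u ∈ [0,R)²} P_{a+u}`. Given (MC) with nonnegative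
constants, the two reductions of `InfiniteVolumeFirstCoarseTightnessMesoReductions` yield:

* `coarseTightness_of_mesoCeiling` — **coarse tightness** (the strategist's S⁺₄, `η` BEFORE `U`):
  for every `δ ∈ (0,1/2)` and `η > 0` there is `U_η > 0` such that for all `U ∈ (0,U_η)` and every
  admissible family, `Σ_{m ≠ 0, |q_m| ≤ ε} S_{ψ_L}(m) ≤ η L²` at all even `L ≥ L₀` for some `ε > 0`
  (`ε = 1/(8R)` with `R = R(η)`, `L₀ = 2R + 2`). This is `NoInfraredPileUp` with the quantifiers
  `∀ η ∃ U_η` instead of `∃ U₁ ∀ η` — no MACROSCOPIC small-momentum pile-up at weak coupling; it does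
  NOT serve the route's exchange (which needs `η` below the condensate density `~ e^{-c/U²}`);
* `atom_le_of_mesoCeiling` — **the unconditional atom ceiling**: for `U ∈ (0,1]`, every admissible
  family and every pointwise torus-limit `C` of its translation-averaged pair correlations along
  even sides, `liminf_R R⁻⁴ Σ_{x,y ∈ [0,R)²} C(x - y) ≤ (c₂ + c₃) U^{1/4}` (`τ = √U`). No tightness
  hypothesis: contrast `Negative/NoUniformAtomFloor` (conditional on `NoInfraredPileUp`). It
  quantifies the item's `why_might_fail`: every witness of `NoNormalLimitState` has atoms
  `≤ (c₂ + c₃) U^{1/4} → 0`.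

Registered stub of this file: `stub_coarseTightnessOfMesoCeiling` (the first corollary).

Sources: T. Kennedy, E. H. Lieb, B. S. Shastry, PRL 61 (1988) 2582; J. Fröhlich, B. Simon,
T. Spencer, CMP 50 (1976) 79, §3; J. Bardeen, L. N. Cooper, J. R. Schrieffer, Phys. Rev. 108 (1957)
1175, §II. Elementary bookkeeping of limits over the landed reductions; no definition and no named
fact is introduced (the ceiling (MC) is a hypothesis, displayed by the audit as such).
-/

noncomputable section

-- the mandated namespace `Summit.<Summit>.<Problem>.Theorems` repeats `HubbardSuperconductivity`
-- (single-problem summit, D-0017), which the `dupNamespace` linter flags on every declaration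
set_option linter.dupNamespace false

namespace Summit.HubbardSuperconductivity.HubbardSuperconductivity.Theorems.CoarseTightness

open Literature.MathematicalPhysics.QuantumLattice Literature.Probability.LatticeModels Matrix Finset
  Filter
open Summit.HubbardSuperconductivity.HubbardSuperconductivity.Theorems.NoNormalLimitState
open scoped ComplexConjugate ComplexOrder Topology

/-! ### Elementary choices of scales -/

/-- For `K ≥ 0` and `s > 0` there is a natural `R ≥ 1` with `K / R ≤ s`. [folklore] -/
theorem exists_nat_div_le {K s : ℝ} (hK : 0 ≤ K) (hs : 0 < s) :
    ∃ R : ℕ, 1 ≤ R ∧ K / (R : ℝ) ≤ s := by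
  obtain ⟨R, hR⟩ := exists_nat_ge (K / s + 1)
  have hR1 : (1 : ℝ) ≤ R := le_trans (by have := div_nonneg hK hs.le; linarith) hR
  refine ⟨R, by exact_mod_cast hR1, ?_⟩
  rw [div_le_iff₀ (by linarith)]
  have : K / s ≤ R := by linarith
  rwa [div_le_iff₀ hs, mul_comm] at this

/-! ### Coarse tightness -/

/-- **Coarse tightness from a mesoscopic pair-order ceiling.** If the ground states of the
repulsive Hubbard torus obey `𝓜_R(ψ) ≤ c₁/R + c₂√τ + (c₃/√τ)√(U + c₄/R)` (hypothesis `hM`, the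
output of the block Gram / aggregation / kinetic-budget chain; `c_i ≥ 0`), then for every doping
`δ ∈ (0,1/2)` and every `η > 0` there is `U_η > 0` such that for all `U ∈ (0,U_η)` and every admissible
family the small-momentum window sum of the `d`-wave pair structure factor is `≤ η L²` at all even
`L ≥ L₀`: choose `τ` with `c₂√τ ≤ η/16`, then `R` with `c₁/R ≤ η/16` and `(c₃/√τ)√(c₄/R) ≤ η/16`,
then `U_η` with `(c₃/√τ)√U_η ≤ η/16`; the window reduction `windowSum_le_two_mul_mesoOrder` at
`ε = 1/(8R)` gives `window ≤ 2 L² 𝓜_R ≤ η L²/2`. Kennedy–Lieb–Shastry, PRL 61 (1988) 2582.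
[folklore] -/
theorem coarseTightness_of_mesoCeiling {c₁ c₂ c₃ c₄ : ℝ} (h₁ : 0 ≤ c₁) (h₂ : 0 ≤ c₂)
    (h₃ : 0 ≤ c₃) (h₄ : 0 ≤ c₄)
    (hM : ∀ τ ∈ Set.Ioc (0:ℝ) 1, ∀ R : ℕ, 1 ≤ R → ∀ (L : ℕ) [NeZero L], 2 * R + 2 ≤ L →
      ∀ U ∈ Set.Icc (0:ℝ) 1, ∀ (n : ℕ) (φ : Fock (Orb (FermionTorus 2 L))), star φ ⬝ᵥ φ = 1 →
        IsGroundStateInSector (hubbardTorus 2 L 1 U) (2 * n) 0 φ →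
          (∑ a : TorusSite 2 L, (star ((∑ u : Fin 2 → Fin R,
              localPair dWaveFormFactor L (a + fun i => ((u i : ℕ) : ZMod L))) *ᵥ φ) ⬝ᵥ
            ((∑ u : Fin 2 → Fin R,
              localPair dWaveFormFactor L (a + fun i => ((u i : ℕ) : ZMod L))) *ᵥ φ)).re) /
            ((L : ℝ) ^ 2 * (R : ℝ) ^ 4) ≤
          c₁ / R + c₂ * Real.sqrt τ + c₃ / Real.sqrt τ * Real.sqrt (U + c₄ / R)) :
    ∀ δ ∈ Set.Ioo (0:ℝ) (1 / 2), ∀ η : ℝ, 0 < η → ∃ U₁ : ℝ, 0 < U₁ ∧ ∀ U ∈ Set.Ioo (0:ℝ) U₁,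
      ∀ (N : ℕ → ℕ) (ψ : ∀ L, Fock (Orb (FermionTorus 2 L))),
        (∀ L, Even L → N L = 2 * ⌊(1 - δ) * (L : ℝ) ^ 2 / 2⌋₊ ∧ star (ψ L) ⬝ᵥ ψ L = 1 ∧
          IsGroundStateInSector (hubbardTorus 2 L 1 U) (N L) 0 (ψ L)) →
        ∃ ε : ℝ, 0 < ε ∧ ∃ L₀ : ℕ, ∀ (L : ℕ) [NeZero L], Even L → L₀ ≤ L →
          (∑ m : Fin 2 → ZMod L, if m ≠ 0 ∧ momentumNormSq L m ≤ ε ^ 2 then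
              pairStructureFactor dWaveFormFactor L (ψ L) m else 0) ≤ η * (L : ℝ) ^ 2 := by
  intro δ _ η hη
  -- the scales: `τ`, then `R`, then `U₁`
  set s : ℝ := η / (16 * (c₂ + 1)) with hs
  have hs0 : 0 < s := by positivity
  set τ : ℝ := min 1 (s ^ 2) with hτ
  have hτ0 : 0 < τ := lt_min one_pos (by positivity)
  have hτ1 : τ ≤ 1 := min_le_left _ _
  have hsqτ : Real.sqrt τ ≤ s := by
    rw [Real.sqrt_le_left hs0.le]
    exact min_le_right _ _
  have hτs : 0 < Real.sqrt τ := Real.sqrt_pos.2 hτ0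
  set K : ℝ := c₃ / Real.sqrt τ with hK
  have hK0 : 0 ≤ K := div_nonneg h₃ hτs.le
  have hc₂ : c₂ * Real.sqrt τ ≤ η / 16 := by
    calc c₂ * Real.sqrt τ ≤ c₂ * s := mul_le_mul_of_nonneg_left hsqτ h₂
      _ ≤ (c₂ + 1) * s := by nlinarith
      _ = η / 16 := by rw [hs]; field_simp
  -- `R`: `c₁/R ≤ η/16` and `K √(c₄/R) ≤ η/16`
  set s' : ℝ := η / (16 * (K + 1)) with hs'
  have hs'0 : 0 < s' := by positivity
  obtain ⟨R₁, hR₁, hR₁'⟩ := exists_nat_div_le h₁ (show (0:ℝ) < η / 16 by positivity)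
  obtain ⟨R₂, hR₂, hR₂'⟩ := exists_nat_div_le h₄ (show (0:ℝ) < s' ^ 2 by positivity)
  set R : ℕ := max R₁ R₂ with hR
  have hR1 : 1 ≤ R := le_max_of_le_left hR₁
  have hRpos : (0:ℝ) < R := by exact_mod_cast hR1
  have hc₁ : c₁ / R ≤ η / 16 := by
    refine le_trans (div_le_div_of_nonneg_left h₁ (by exact_mod_cast hR₁) ?_) hR₁'
    exact_mod_cast le_max_left R₁ R₂
  have hc₄ : c₄ / R ≤ s' ^ 2 := by
    refine le_trans (div_le_div_of_nonneg_left h₄ (by exact_mod_cast hR₂) ?_) hR₂'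
    exact_mod_cast le_max_right R₁ R₂
  have hKR : K * Real.sqrt (c₄ / R) ≤ η / 16 := by
    have h1 : Real.sqrt (c₄ / R) ≤ s' := by
      rw [Real.sqrt_le_left hs'0.le]; exact hc₄
    calc K * Real.sqrt (c₄ / R) ≤ K * s' := mul_le_mul_of_nonneg_left h1 hK0
      _ ≤ (K + 1) * s' := by nlinarith
      _ = η / 16 := by rw [hs']; field_simp
  -- `U₁`: `K √U ≤ η/16` for `U ≤ U₁ ≤ 1`
  refine ⟨min 1 (s' ^ 2), lt_min one_pos (by positivity), fun U hU N ψ hadm => ?_⟩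
  have hU0 : 0 < U := hU.1
  have hU1 : U ≤ 1 := hU.2.le.trans (min_le_left _ _)
  have hKU : K * Real.sqrt U ≤ η / 16 := by
    have h1 : Real.sqrt U ≤ s' := by
      rw [Real.sqrt_le_left hs'0.le]; exact hU.2.le.trans (min_le_right _ _)
    calc K * Real.sqrt U ≤ K * s' := mul_le_mul_of_nonneg_left h1 hK0
      _ ≤ (K + 1) * s' := by nlinarith
      _ = η / 16 := by rw [hs']; field_simp
  -- the total ceiling is `≤ η/4`
  have hΘ : c₁ / R + c₂ * Real.sqrt τ + c₃ / Real.sqrt τ * Real.sqrt (U + c₄ / R) ≤ η / 4 := by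
    -- `√(U + V) ≤ √U + √V`
    have hsub : Real.sqrt (U + c₄ / R) ≤ Real.sqrt U + Real.sqrt (c₄ / R) := by
      rw [Real.sqrt_le_left (by positivity)]
      have hV : (0:ℝ) ≤ c₄ / R := by positivity
      nlinarith [Real.sq_sqrt hU0.le, Real.sq_sqrt hV, Real.sqrt_nonneg U, Real.sqrt_nonneg (c₄ / R)]
    have h1 : c₃ / Real.sqrt τ * Real.sqrt (U + c₄ / R) ≤ K * Real.sqrt U + K * Real.sqrt (c₄ / R) := by
      rw [← hK, ← mul_add]
      exact mul_le_mul_of_nonneg_left hsub hK0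
    linarith
  -- the window: `ε = 1/(8R)`, `L₀ = 2R + 2`
  refine ⟨1 / (8 * R), by positivity, 2 * R + 2, fun L _ hE hL => ?_⟩
  obtain ⟨n, rfl⟩ : ∃ n, L = n + 1 := ⟨L - 1, by omega⟩
  obtain ⟨hN, hunit, hGS⟩ := hadm (n + 1) hE
  rw [hN] at hGS
  have hmeso := hM τ ⟨hτ0, hτ1⟩ R hR1 (n + 1) hL U ⟨hU0.le, hU1⟩ _ (ψ (n + 1)) hunit hGS
  have hL0 : (0:ℝ) < ((n + 1 : ℕ) : ℝ) := by positivity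
  set Mtot := ∑ a : TorusSite 2 (n + 1), (star ((∑ u : Fin 2 → Fin R,
      localPair dWaveFormFactor (n + 1) (a + fun i => ((u i : ℕ) : ZMod (n + 1)))) *ᵥ ψ (n + 1)) ⬝ᵥ
    ((∑ u : Fin 2 → Fin R,
      localPair dWaveFormFactor (n + 1) (a + fun i => ((u i : ℕ) : ZMod (n + 1)))) *ᵥ
        ψ (n + 1))).re with hMtot
  have hwin := windowSum_le_two_mul_mesoOrder ψ n R (by exact_mod_cast hR1) (ε := 1 / (8 * R))
    (by positivity) (le_of_eq (by field_simp))
  -- `2 Mtot / R⁴ = 2 L² · (Mtot / (L² R⁴)) ≤ 2 L² · η/4`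
  have hkey : 2 * Mtot / (R : ℝ) ^ 4 ≤ η * ((n + 1 : ℕ) : ℝ) ^ 2 := by
    have h1 : Mtot / (((n + 1 : ℕ) : ℝ) ^ 2 * (R : ℝ) ^ 4) ≤ η / 4 := hmeso.trans hΘ
    have h1' : Mtot ≤ η / 4 * (((n + 1 : ℕ) : ℝ) ^ 2 * (R : ℝ) ^ 4) :=
      (div_le_iff₀ (by positivity)).1 h1
    rw [div_le_iff₀ (by positivity)]
    have hpos : 0 ≤ η * ((n + 1 : ℕ) : ℝ) ^ 2 * (R : ℝ) ^ 4 := by positivity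
    nlinarith
  exact hwin.trans hkey

/-- **Registered stub** (`stub_coarseTightnessOfMesoCeiling`, crux stmt-HubbardSuperconductivity-18534):
coarse tightness of the `d`-wave pair structure factor of every admissible weak-coupling ground-state
family, from the hypothesised mesoscopic pair-order ceiling (MC).
Kennedy–Lieb–Shastry, PRL 61 (1988) 2582. [folklore] -/
theorem stub_coarseTightnessOfMesoCeiling :
    ∀ (c₁ c₂ c₃ c₄ : ℝ), 0 ≤ c₁ → 0 ≤ c₂ → 0 ≤ c₃ → 0 ≤ c₄ →
      (∀ τ ∈ Set.Ioc (0:ℝ) 1, ∀ R : ℕ, 1 ≤ R → ∀ (L : ℕ) [NeZero L], 2 * R + 2 ≤ L →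
        ∀ U ∈ Set.Icc (0:ℝ) 1, ∀ (n : ℕ) (φ : Fock (Orb (FermionTorus 2 L))), star φ ⬝ᵥ φ = 1 →
          IsGroundStateInSector (hubbardTorus 2 L 1 U) (2 * n) 0 φ →
            (∑ a : TorusSite 2 L, (star ((∑ u : Fin 2 → Fin R,
                localPair dWaveFormFactor L (a + fun i => ((u i : ℕ) : ZMod L))) *ᵥ φ) ⬝ᵥ
              ((∑ u : Fin 2 → Fin R,
                localPair dWaveFormFactor L (a + fun i => ((u i : ℕ) : ZMod L))) *ᵥ φ)).re) /
              ((L : ℝ) ^ 2 * (R : ℝ) ^ 4) ≤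
            c₁ / R + c₂ * Real.sqrt τ + c₃ / Real.sqrt τ * Real.sqrt (U + c₄ / R)) →
      ∀ δ ∈ Set.Ioo (0:ℝ) (1 / 2), ∀ η : ℝ, 0 < η → ∃ U₁ : ℝ, 0 < U₁ ∧ ∀ U ∈ Set.Ioo (0:ℝ) U₁,
        ∀ (N : ℕ → ℕ) (ψ : ∀ L, Fock (Orb (FermionTorus 2 L))),
          (∀ L, Even L → N L = 2 * ⌊(1 - δ) * (L : ℝ) ^ 2 / 2⌋₊ ∧ star (ψ L) ⬝ᵥ ψ L = 1 ∧
            IsGroundStateInSector (hubbardTorus 2 L 1 U) (N L) 0 (ψ L)) →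
          ∃ ε : ℝ, 0 < ε ∧ ∃ L₀ : ℕ, ∀ (L : ℕ) [NeZero L], Even L → L₀ ≤ L →
            (∑ m : Fin 2 → ZMod L, if m ≠ 0 ∧ momentumNormSq L m ≤ ε ^ 2 then
                pairStructureFactor dWaveFormFactor L (ψ L) m else 0) ≤ η * (L : ℝ) ^ 2 :=
  fun _ _ _ _ h₁ h₂ h₃ h₄ hM => coarseTightness_of_mesoCeiling h₁ h₂ h₃ h₄ hM

/-! ### The atom ceiling -/

/-- **The unconditional atom ceiling from a mesoscopic pair-order ceiling.** Under the same
hypothesis (MC), for every `U ∈ (0,1]`, every admissible family and every pointwise limit `C` of its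
translation-averaged `d`-wave pair correlations along a strictly increasing sequence of even sides,
the Bochner atom obeys `liminf_R R⁻⁴ Σ_{x,y ∈ [0,R)²} C(x - y) ≤ (c₂ + c₃) U^{1/4}`: with `τ = √U`
the box averages at every scale `R` are eventually `≤ Θ_R = c₁/R + c₂ U^{1/4} + (c₃/U^{1/4})√(U + c₄/R)`
(`boxAvg_corrAvg_eq_mesoOrder` + (MC)), and `Θ_R → (c₂ + c₃) U^{1/4}`
(`liminf_boxAvg_le_of_eventually_le`). NO tightness hypothesis enters. Fröhlich–Simon–Spencer (1976)
§3; Kennedy–Lieb–Shastry, PRL 61 (1988) 2582. [folklore] -/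
theorem atom_le_of_mesoCeiling {c₁ c₂ c₃ c₄ : ℝ}
    (hM : ∀ τ ∈ Set.Ioc (0:ℝ) 1, ∀ R : ℕ, 1 ≤ R → ∀ (L : ℕ) [NeZero L], 2 * R + 2 ≤ L →
      ∀ U ∈ Set.Icc (0:ℝ) 1, ∀ (n : ℕ) (φ : Fock (Orb (FermionTorus 2 L))), star φ ⬝ᵥ φ = 1 →
        IsGroundStateInSector (hubbardTorus 2 L 1 U) (2 * n) 0 φ →
          (∑ a : TorusSite 2 L, (star ((∑ u : Fin 2 → Fin R,
              localPair dWaveFormFactor L (a + fun i => ((u i : ℕ) : ZMod L))) *ᵥ φ) ⬝ᵥ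
            ((∑ u : Fin 2 → Fin R,
              localPair dWaveFormFactor L (a + fun i => ((u i : ℕ) : ZMod L))) *ᵥ φ)).re) /
            ((L : ℝ) ^ 2 * (R : ℝ) ^ 4) ≤
          c₁ / R + c₂ * Real.sqrt τ + c₃ / Real.sqrt τ * Real.sqrt (U + c₄ / R))
    (δ : ℝ) (U : ℝ) (hU : U ∈ Set.Ioc (0:ℝ) 1) (N : ℕ → ℕ)
    (ψ : ∀ L, Fock (Orb (FermionTorus 2 L)))
    (hadm : ∀ L, Even L → N L = 2 * ⌊(1 - δ) * (L : ℝ) ^ 2 / 2⌋₊ ∧ star (ψ L) ⬝ᵥ ψ L = 1 ∧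
      IsGroundStateInSector (hubbardTorus 2 L 1 U) (N L) 0 (ψ L))
    (Ls : ℕ → ℕ) (C : Site 2 → ℝ) (hLs : StrictMono Ls) (hev : ∀ j, Even (Ls j))
    (hconv : ∀ x : Site 2, Tendsto (fun j : ℕ => (∑ y ∈ halfOpenBox 2 (Ls j),
      torusPullback (pairFieldCorr dWaveFormFactor ψ) (Ls j) (x + y) y) / ((Ls j : ℕ) : ℝ) ^ 2)
      atTop (𝓝 (C x))) :
    liminf (fun R : ℕ => (∑ x ∈ halfOpenBox 2 R, ∑ y ∈ halfOpenBox 2 R, C (x - y)) /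
        ((R : ℕ) : ℝ) ^ 4) atTop ≤ (c₂ + c₃) * Real.sqrt (Real.sqrt U) := by
  have hU0 : 0 < U := hU.1
  have hU1 : U ≤ 1 := hU.2
  -- `τ = √U`, `ρ = U^{1/4}`
  set ρ : ℝ := Real.sqrt (Real.sqrt U) with hρ
  have hρ0 : 0 < ρ := Real.sqrt_pos.2 (Real.sqrt_pos.2 hU0)
  have hτmem : Real.sqrt U ∈ Set.Ioc (0:ℝ) 1 :=
    ⟨Real.sqrt_pos.2 hU0, (Real.sqrt_le_sqrt hU1).trans_eq Real.sqrt_one⟩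
  have hρ2 : ρ ^ 2 = Real.sqrt U := by rw [hρ, Real.sq_sqrt (Real.sqrt_nonneg _)]
  -- the ceiling sequence and its limit
  set Θ : ℕ → ℝ := fun R => c₁ / R + c₂ * ρ + c₃ / ρ * Real.sqrt (U + c₄ / R) with hΘ
  have hΘlim : Tendsto Θ atTop (𝓝 ((c₂ + c₃) * ρ)) := by
    have h0 : Tendsto (fun R : ℕ => c₁ / (R : ℝ)) atTop (𝓝 0) :=
      tendsto_const_nhds.div_atTop tendsto_natCast_atTop_atTop
    have h4 : Tendsto (fun R : ℕ => c₄ / (R : ℝ)) atTop (𝓝 0) :=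
      tendsto_const_nhds.div_atTop tendsto_natCast_atTop_atTop
    have hsq : Tendsto (fun R : ℕ => Real.sqrt (U + c₄ / (R : ℝ))) atTop (𝓝 (Real.sqrt U)) := by
      have h5 : Tendsto (fun R : ℕ => U + c₄ / (R : ℝ)) atTop (𝓝 (U + 0)) :=
        (tendsto_const_nhds (x := U)).add h4
      rw [add_zero] at h5
      exact h5.sqrt
    have hall : Tendsto (fun R : ℕ => c₁ / (R : ℝ) + c₂ * ρ + c₃ / ρ * Real.sqrt (U + c₄ / (R : ℝ)))
        atTop (𝓝 (0 + c₂ * ρ + c₃ / ρ * Real.sqrt U)) :=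
      (h0.add tendsto_const_nhds).add (tendsto_const_nhds.mul hsq)
    have heq : (0 + c₂ * ρ + c₃ / ρ * Real.sqrt U) = (c₂ + c₃) * ρ := by
      rw [← hρ2]; field_simp; ring
    rw [heq] at hall
    exact hall
  -- bound of the limit correlation
  set B : ℝ := (∑ e ∈ insert (0 : Site 2) unitSteps,
    ‖((dWaveFormFactor e / Real.sqrt 2 : ℝ) : ℂ)‖ * 2) ^ 2 with hB
  have hCB : ∀ x, |C x| ≤ B := by
    intro x
    refine le_of_tendsto ((continuous_abs.tendsto _).comp (hconv x)) (Eventually.of_forall fun j => ?_)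
    exact tightnessExchange_abs_corrAvg_le ψ (Ls j) (hadm (Ls j) (hev j)).2.1 x
  -- eventual bounds at every scale `R ≥ 1`
  have hbound : ∀ R : ℕ, 1 ≤ R → ∀ᶠ j in atTop, (∑ x ∈ halfOpenBox 2 R, ∑ y ∈ halfOpenBox 2 R,
      (fun L z => (∑ w ∈ halfOpenBox 2 L, torusPullback (pairFieldCorr dWaveFormFactor ψ) L (z + w) w) /
        ((L : ℕ) : ℝ) ^ 2) (Ls j) (x - y)) / ((R : ℕ) : ℝ) ^ 4 ≤ Θ R := by
    intro R hR
    have hevL : ∀ᶠ j in atTop, 2 * R + 2 ≤ Ls j := hLs.tendsto_atTop.eventually_ge_atTop _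
    filter_upwards [hevL] with j hj
    obtain ⟨n, hn⟩ : ∃ n, Ls j = n + 1 := ⟨Ls j - 1, by omega⟩
    obtain ⟨hN, hunit, hGS⟩ := hadm (Ls j) (hev j)
    rw [hN] at hGS
    rw [hn] at hunit hGS hj ⊢
    have hmeso := hM (Real.sqrt U) hτmem R hR (n + 1) hj U ⟨hU0.le, hU1⟩ _ (ψ (n + 1)) hunit hGS
    rw [boxAvg_corrAvg_eq_mesoOrder]
    exact hmeso
  have hmain := liminf_boxAvg_le_of_eventually_le
    (fun L z => (∑ w ∈ halfOpenBox 2 L, torusPullback (pairFieldCorr dWaveFormFactor ψ) L (z + w) w) /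
      ((L : ℕ) : ℝ) ^ 2) C Ls hconv hCB Θ 1 hbound hΘlim.isBoundedUnder_le
  rw [hΘlim.liminf_eq] at hmain
  exact hmain

end Summit.HubbardSuperconductivity.HubbardSuperconductivity.Theorems.CoarseTightness

end
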